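import Summits.SmoothPoincare4.SmoothPoincare4.Theorems.DottedCircleRasmussenDcrGapHelperFriendsCarrierVkPartAPushGlue
import Summits.SmoothPoincare4.SmoothPoincare4.Theorems.DottedCircleRasmussenDcrGapHelperFriendsCarrierVkPartAPushPrelim

/-!
# Helper `helper_friendsCarrier_Vk_partA_pushLocal` (piece 12 of the registered stub
`helper_friendsCarrier_Vk_partA`, line `mk_friends`, skeleton v8) for crux `DcrGap`
(item stmt-SmoothPoincare4-16128, route route-SmoothPoincare4-DottedCircleRasmussen)

**The push-off input of Part A from the two homological facts about THIS knot and THIS disc.**  The one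
remaining debt of V_k part A after `…VkPartAInputOfPush` is the push-off input: the fibre-coordinate loop
of a push-off `νK(u, s e₀)` of the model knot, read in the affine tube `F` of the enlarged model slice disc
on a transversal pair `(m₀, m₁)`, is null-homotopic in `ℝ² ∖ 0`.  This file derives it from two
homological facts, stated for the given knot/tube `νK` and disc `f₁` only (the lead registers their
general forms as the two parts of the split):

* (I) every push-off `t ↦ νK(e^{2πit}, s e₀)`, `s > 0`, is null-homologous in `M_k ∖ K₁`
  (Hurewicz class `0`; the tube framing is the Seifert framing — picture `0`-framing, `IsNullHomologous`);
* (III) for `δ` in the neat zone and small `κ`, in `Z = ℝ⁴ ∖ (f₁(B̄(0,1+δ)) ∪ D_k^{≤ 1-κ})` the boundary of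
  every small flat disc transverse to the enlarged disc at a point off `D_k^{≤1-κ}` has infinite order in
  `H₁(Z; ℤ)` (the disc framing is the Seifert framing — `IsNullHomologous`).

Bookkeeping (differential topology only): shrink the disc radius into the neat zone (`exists_neatZone`),
choose `κ` below the rim levels, a thin tube `F(B(0,1+δ') × B(0,η'))` whose punctured part lies in `Z`
(continuity and compactness: the disc part `f₁(B̄(0,1+δ'))` misses the closed `D_k^{≤1-κ}`), a small
push-off inside it (`exists_pushOff_mem`), apply the glue `…VkPartAPushGlue` (facts (I), (III) feed its two
hypotheses: `M_k ∖ K₁ ⊆ Z`, and the meridians of the glue are boundaries of flat punctured discs in the thin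
tube), and finally move the push-off parameter from `s'` to the given `s` (the fibre coordinates never
vanish, `eq_of_apply_eq_disc`).

* `helper_friendsCarrier_Vk_partA_pushLocal` — the registered statement.

No definitions, no named facts, no `sorry`.

## References

* R. C. Kirby, *The Topology of 4-Manifolds*, LNM 1374 (1989), Ch. I §2. [Kirby1989]
* A. Hatcher, *Algebraic Topology*, CUP (2002), Thm. 2A.1. [HatcherAT2002]
-/

-- the prescribed namespace `Summit.<P>.<Sub>.…` duplicates `SmoothPoincare4` (P = Sub)
set_option linter.dupNamespace false
set_option linter.style.longLine false

noncomputable section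

open scoped Manifold ContDiff Topology
open Set Function Metric Filter Complex
open Literature.Topology.FourManifolds Literature.Topology.FourManifolds.MMSW Literature.Topology.FourManifolds.PlaneComplex
  Literature.AlgebraicTopology.SingularHomology

namespace Summit.SmoothPoincare4.SmoothPoincare4.Theorems.DcrGap.MkFriends

namespace FriendsCarrierVk

variable {k : ℕ} {K₁ : (sphere (0 : EuclideanSpace ℝ (Fin 2)) 1) → EuclideanSpace ℝ (Fin 4)}
  {f₁ : EuclideanSpace ℝ (Fin 2) → EuclideanSpace ℝ (Fin 4)}
  {νK : (sphere (0 : EuclideanSpace ℝ (Fin 2)) 1) × EuclideanSpace ℝ (Fin 2) → EuclideanSpace ℝ (Fin 4)}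

set_option maxHeartbeats 400000 in
/-- **The push-off input from the two local homological facts.** [cite: Kirby1989, Ch. I §2] -/
theorem pushOff_of_localFacts (hK : IsModelKnot k K₁) (hf : IsModelSliceDisc k K₁ f₁)
    (hneat : ∀ t : (sphere (0 : EuclideanSpace ℝ (Fin 2)) 1), deriv (fun ρ : ℝ => levelFun k (f₁ (ρ • (t : EuclideanSpace ℝ (Fin 2))))) 1 < 0)
    (hν : ContMDiff ((𝓡 1).prod 𝓘(ℝ, EuclideanSpace ℝ (Fin 2))) 𝓘(ℝ, EuclideanSpace ℝ (Fin 4)) ∞ νK)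
    (hνinj : Injective νK) (hνM : ∀ p, νK p ∈ modelBoundary k) (hν0 : ∀ u : (sphere (0 : EuclideanSpace ℝ (Fin 2)) 1), νK (u, 0) = K₁ u)
    (hI : ∀ (s : ℝ), 0 < s → ∀ (p : ↥{y : EuclideanSpace ℝ (Fin 4) | y ∈ modelBoundary k ∧ y ∉ range K₁}) (γ : Path p p),
      (∀ t, ((γ t : ↥{y : EuclideanSpace ℝ (Fin 4) | y ∈ modelBoundary k ∧ y ∉ range K₁}) : EuclideanSpace ℝ (Fin 4)) =
        νK (circlePoint (2 * Real.pi * t), s • EuclideanSpace.single 0 1)) → loopClass ℤ ℤ (1 : ℤ) γ = 0)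
    (hIII : ∀ (δ κ : ℝ) (Zs : Set (EuclideanSpace ℝ (Fin 4))), Zs = {y | y ∉ f₁ '' closedBall 0 (1 + δ) ∧ ¬ ((∀ j, (1 : ℝ) ≤ holeTerm k j y) ∧ levelFun k y ≤ 1 - κ)} →
      0 < δ → 0 < κ → κ ≤ 1 / 20 → InjOn f₁ (closedBall 0 (1 + δ)) →
      (∀ x : EuclideanSpace ℝ (Fin 2), 1 ≤ ‖x‖ → ‖x‖ ≤ 1 + δ → Injective (fderiv ℝ f₁ x) ∧ (∀ j, (1 : ℝ) / 2 < holeTerm k j (f₁ x)) ∧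
        fderiv ℝ (fun y => levelFun k (f₁ y)) x (‖x‖⁻¹ • x) < 0) →
      (∀ u : (sphere (0 : EuclideanSpace ℝ (Fin 2)) 1), levelFun k (f₁ ((1 + δ) • (u : EuclideanSpace ℝ (Fin 2)))) < 1 - κ) →
      ∀ (x₀ : EuclideanSpace ℝ (Fin 2)) (n₀ n₁ : EuclideanSpace ℝ (Fin 4)) (c : ℂ), ‖x₀‖ < 1 + δ →
      ¬ ((∀ j, (1 : ℝ) ≤ holeTerm k j (f₁ x₀)) ∧ levelFun k (f₁ x₀) ≤ 1 - κ) →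
      (∀ (e : EuclideanSpace ℝ (Fin 2)) (α β : ℝ), fderiv ℝ f₁ x₀ e + α • n₀ + β • n₁ = 0 → e = 0 ∧ α = 0 ∧ β = 0) → c ≠ 0 →
      (∀ z : ℂ, z ≠ 0 → ‖z‖ ≤ ‖c‖ → f₁ x₀ + (ofC z) 0 • n₀ + (ofC z) 1 • n₁ ∈ Zs) →
      ∀ (p : ↥Zs) (μ : Path p p), (∀ t, ((μ t : ↥Zs) : EuclideanSpace ℝ (Fin 4)) =
        f₁ x₀ + (ofC (Complex.exp (((2 * Real.pi * t : ℝ) : ℂ) * Complex.I) * c)) 0 • n₀ + (ofC (Complex.exp (((2 * Real.pi * t : ℝ) : ℂ) * Complex.I) * c)) 1 • n₁) →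
      ∀ n : ℤ, n • loopClass ℤ ℤ (1 : ℤ) μ = 0 → n = 0)
    (m₀ m₁ : EuclideanSpace ℝ (Fin 2) → EuclideanSpace ℝ (Fin 4))
    (F : EuclideanSpace ℝ (Fin 2) × EuclideanSpace ℝ (Fin 2) → EuclideanSpace ℝ (Fin 4))
    (Finv : EuclideanSpace ℝ (Fin 4) → EuclideanSpace ℝ (Fin 2) × EuclideanSpace ℝ (Fin 2)) (δ η s : ℝ)
    (hF : ∀ q, F q = f₁ q.1 + q.2 0 • m₀ q.1 + q.2 1 • m₁ q.1) (hFc : Continuous F) (hδ : 0 < δ) (hη : 0 < η) (hs : 0 < s)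
    (hinjf : InjOn f₁ (closedBall 0 (1 + δ)))
    (htr : ∀ x ∈ ball (0 : EuclideanSpace ℝ (Fin 2)) (1 + 2 * δ), ∀ (e : EuclideanSpace ℝ (Fin 2)) (α β : ℝ), fderiv ℝ f₁ x e + α • m₀ x + β • m₁ x = 0 → e = 0 ∧ α = 0 ∧ β = 0)
    (hinjF : InjOn F (closedBall (0 : EuclideanSpace ℝ (Fin 2)) (1 + δ) ×ˢ closedBall (0 : EuclideanSpace ℝ (Fin 2)) η))
    (hopen : IsOpen (F '' (ball (0 : EuclideanSpace ℝ (Fin 2)) (1 + δ) ×ˢ ball (0 : EuclideanSpace ℝ (Fin 2)) η)))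
    (hFinvc : ContinuousOn Finv (F '' (ball (0 : EuclideanSpace ℝ (Fin 2)) (1 + δ) ×ˢ ball (0 : EuclideanSpace ℝ (Fin 2)) η)))
    (hleft : ∀ q ∈ ball (0 : EuclideanSpace ℝ (Fin 2)) (1 + δ) ×ˢ ball (0 : EuclideanSpace ℝ (Fin 2)) η, Finv (F q) = q)
    (hcol : ∀ (u : (sphere (0 : EuclideanSpace ℝ (Fin 2)) 1)) (ρ : ℝ), 1 < ρ → ρ ≤ 1 + δ → levelFun k (f₁ (ρ • (u : EuclideanSpace ℝ (Fin 2)))) < 1)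
    (hpush : ∀ (u : (sphere (0 : EuclideanSpace ℝ (Fin 2)) 1)) (t : ℝ), 0 < t → t ≤ s → νK (u, t • EuclideanSpace.single 0 1) ∈ F '' (ball (0 : EuclideanSpace ℝ (Fin 2)) (1 + δ) ×ˢ ball (0 : EuclideanSpace ℝ (Fin 2)) η)) :
    ∃ G : unitInterval × (sphere (0 : EuclideanSpace ℝ (Fin 2)) 1) → EuclideanSpace ℝ (Fin 2), Continuous G ∧ (∀ p, G p ≠ 0) ∧
      (∀ u, G (0, u) = (Finv (νK (u, s • EuclideanSpace.single 0 1))).2) ∧ ∃ e : EuclideanSpace ℝ (Fin 2), ∀ u, G (1, u) = e := by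
  have hfs : ContDiff ℝ ∞ f₁ := contMDiff_iff_contDiff.1 hf.1
  set dom : Set (EuclideanSpace ℝ (Fin 2) × EuclideanSpace ℝ (Fin 2)) :=
    ball (0 : EuclideanSpace ℝ (Fin 2)) (1 + δ) ×ˢ ball (0 : EuclideanSpace ℝ (Fin 2)) η with hdom
  have hF0 : ∀ x, F (x, 0) = f₁ x := fun x => by simp [hF]
  have hright : ∀ y ∈ F '' dom, F (Finv y) = y := by
    rintro _ ⟨q, hq, rfl⟩; rw [hleft q hq]
  -- the fibre coordinates of the push-offs never vanish on `(0, s]`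
  have hne : ∀ (u : (sphere (0 : EuclideanSpace ℝ (Fin 2)) 1)) (t : ℝ), 0 < t → t ≤ s →
      (Finv (νK (u, t • EuclideanSpace.single 0 1))).2 ≠ 0 := by
    intro u t ht hts hzero
    obtain ⟨q, hq, hqF⟩ := hpush u t ht hts
    have hFq : Finv (νK (u, t • EuclideanSpace.single 0 1)) = q := by rw [← hqF]; exact hleft q hq
    rw [hFq] at hzero
    have hval : νK (u, t • EuclideanSpace.single 0 1) = f₁ q.1 := by
      rw [← hqF, ← hF0]; congr 1; exact Prod.ext rfl hzero
    have := eq_of_apply_eq_disc hf hνinj hνM hν0 hcol (mem_ball_zero_iff.1 hq.1) hval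
    have h1 := congrArg (fun z : EuclideanSpace ℝ (Fin 2) => z 0) this
    simp at h1
    exact ht.ne' h1
  -- Step A: the neat zone, the shrunken radius `δ''`, the depth `κ`
  obtain ⟨δ₂, hδ₂, -, hzone⟩ := exists_neatZone k hK hf hneat
  set δ'' : ℝ := min δ (δ₂ / 2) with hδ''
  have hδ''pos : 0 < δ'' := lt_min hδ (by linarith)
  have hδ''δ : δ'' ≤ δ := min_le_left _ _
  have hδ''₂ : δ'' < δ₂ := lt_of_le_of_lt (min_le_right _ _) (by linarith)
  have hcollar : ∀ x : EuclideanSpace ℝ (Fin 2), 1 ≤ ‖x‖ → ‖x‖ ≤ 1 + δ'' →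
      Injective (fderiv ℝ f₁ x) ∧ (∀ j, (1 : ℝ) / 2 < holeTerm k j (f₁ x)) ∧ fderiv ℝ (fun y => levelFun k (f₁ y)) x (‖x‖⁻¹ • x) < 0 := by
    intro x hx1 hx2
    obtain ⟨hg, hd⟩ := hzone x (by rw [abs_lt]; constructor <;> linarith)
    refine ⟨(injective_iff_map_eq_zero _).2 fun v hv => (htr x (mem_ball_zero_iff.2 (by linarith)) v 0 0 (by rw [hv]; simp)).1, hg, hd⟩
  have hguard : ∀ x : EuclideanSpace ℝ (Fin 2), |‖x‖ - 1| < δ₂ → ∀ j, holeTerm k j (f₁ x) ≠ 0 := fun x hx j =>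
    (one_half_pos.trans ((hzone x hx).1 j)).ne'
  have hlevc : ∀ x : EuclideanSpace ℝ (Fin 2), |‖x‖ - 1| < δ₂ → ContinuousAt (fun y => levelFun k (f₁ y)) x := fun x hx =>
    (contDiffAt_levelFun (hguard x hx)).continuousAt.comp (hfs.continuous.continuousAt)
  have hrim1 : ∀ u : (sphere (0 : EuclideanSpace ℝ (Fin 2)) 1), levelFun k (f₁ ((1 + δ'') • (u : EuclideanSpace ℝ (Fin 2)))) < 1 :=
    fun u => hcol u (1 + δ'') (by linarith) (by linarith)
  obtain ⟨M, hM1, hMle⟩ : ∃ M : ℝ, M < 1 ∧ ∀ u : (sphere (0 : EuclideanSpace ℝ (Fin 2)) 1),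
      levelFun k (f₁ ((1 + δ'') • (u : EuclideanSpace ℝ (Fin 2)))) ≤ M := by
    have hc : Continuous fun u : (sphere (0 : EuclideanSpace ℝ (Fin 2)) 1) => levelFun k (f₁ ((1 + δ'') • (u : EuclideanSpace ℝ (Fin 2)))) := by
      refine continuous_iff_continuousAt.2 fun u => ?_
      have hx : |‖(1 + δ'') • (u : EuclideanSpace ℝ (Fin 2))‖ - 1| < δ₂ := by
        rw [norm_smul, norm_eq_of_mem_sphere u, mul_one, Real.norm_of_nonneg (by linarith), abs_lt]; constructor <;> linarith
      have h2 : Continuous fun u : (sphere (0 : EuclideanSpace ℝ (Fin 2)) 1) => (1 + δ'') • (u : EuclideanSpace ℝ (Fin 2)) := by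
        fun_prop
      exact ContinuousAt.comp (g := fun y => levelFun k (f₁ y)) (f := fun u : (sphere (0 : EuclideanSpace ℝ (Fin 2)) 1) => (1 + δ'') • (u : EuclideanSpace ℝ (Fin 2)))
        (hlevc _ hx) h2.continuousAt
    obtain ⟨um, -, hum⟩ := isCompact_univ.exists_isMaxOn (univ_nonempty) hc.continuousOn
    exact ⟨_, hrim1 um, fun u => hum (mem_univ u)⟩
  set κ : ℝ := min (1 / 20) ((1 - M) / 2) with hκ
  have hκpos : 0 < κ := lt_min (by norm_num) (by linarith)
  have hκ20 : κ ≤ 1 / 20 := min_le_left _ _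
  have hrim : ∀ u : (sphere (0 : EuclideanSpace ℝ (Fin 2)) 1), levelFun k (f₁ ((1 + δ'') • (u : EuclideanSpace ℝ (Fin 2)))) < 1 - κ := fun u => by
    have := hMle u; have h2 : κ ≤ (1 - M) / 2 := min_le_right _ _; linarith
  set Dshr : Set (EuclideanSpace ℝ (Fin 4)) := {y | (∀ j, (1 : ℝ) ≤ holeTerm k j y) ∧ levelFun k y ≤ 1 - κ} with hDshr
  set Z : Set (EuclideanSpace ℝ (Fin 4)) := {y | y ∉ f₁ '' closedBall 0 (1 + δ'') ∧ ¬ ((∀ j, (1 : ℝ) ≤ holeTerm k j y) ∧ levelFun k y ≤ 1 - κ)} with hZ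
  have hDc : IsClosed Dshr := by
    have hG : IsClosed {y : EuclideanSpace ℝ (Fin 4) | ∀ j, (1 : ℝ) ≤ holeTerm k j y} := by
      have : {y : EuclideanSpace ℝ (Fin 4) | ∀ j, (1 : ℝ) ≤ holeTerm k j y} = ⋂ j, {y | (1 : ℝ) ≤ holeTerm k j y} := by ext y; simp
      rw [this]
      refine isClosed_iInter fun j => isClosed_le continuous_const ?_
      unfold holeTerm; fun_prop
    have hcont : ContinuousOn (levelFun k) {y : EuclideanSpace ℝ (Fin 4) | ∀ j, (1 : ℝ) ≤ holeTerm k j y} := fun y hy =>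
      (contDiffAt_levelFun fun j => (one_pos.trans_le (hy j)).ne').continuousAt.continuousWithinAt
    have : Dshr = {y : EuclideanSpace ℝ (Fin 4) | ∀ j, (1 : ℝ) ≤ holeTerm k j y} ∩ (levelFun k) ⁻¹' Iic (1 - κ) := by
      ext y; simp [hDshr]
    rw [this]
    exact hcont.preimage_isClosed_of_isClosed hG isClosed_Iic
  -- `M_k ∖ K₁ ⊆ Z`
  have hMZ : {y : EuclideanSpace ℝ (Fin 4) | y ∈ modelBoundary k ∧ y ∉ range K₁} ⊆ Z := by
    rintro y ⟨hyM, hyK⟩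
    refine ⟨?_, fun h => ?_⟩
    · rintro ⟨x, hx, rfl⟩
      have hx' : ‖x‖ ≤ 1 + δ'' := mem_closedBall_zero_iff.1 hx
      rcases lt_trichotomy ‖x‖ 1 with h1 | h1 | h1
      · exact hf.2.2.2.1 x h1 (modelBoundary_subset_modelHandlebody hyM)
      · let x' : (sphere (0 : EuclideanSpace ℝ (Fin 2)) 1) := ⟨x, by simpa using h1⟩
        exact hyK ⟨x', (hf.2.2.2.2 x').symm⟩
      · set u₁ : (sphere (0 : EuclideanSpace ℝ (Fin 2)) 1) := radialProjection (⟨EuclideanSpace.single 0 1, by simp⟩ : (sphere (0 : EuclideanSpace ℝ (Fin 2)) 1)) x with hu₁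
        have hxu : x = ‖x‖ • (u₁ : EuclideanSpace ℝ (Fin 2)) := (norm_smul_coe_radialProjection _ x).symm
        have := hcol u₁ ‖x‖ h1 (by linarith)
        rw [← hxu, hyM.2] at this
        exact lt_irrefl _ this
    · have := h.2; rw [hyM.2] at this; linarith
  -- Step B: a thin tube whose punctured part lies in `Z`
  -- the disc part over `B̄(0, 1 + δ')` misses `Dshr` once `δ'` is small
  obtain ⟨δ', hδ'pos, hδ'le, hdisc⟩ : ∃ δ' : ℝ, 0 < δ' ∧ δ' < δ'' ∧ ∀ x ∈ closedBall (0 : EuclideanSpace ℝ (Fin 2)) (1 + δ'), f₁ x ∉ Dshr := by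
    -- uniform continuity of the level on the compact collar
    have hK0 : IsCompact (closedBall (0 : EuclideanSpace ℝ (Fin 2)) (1 + δ'') \ ball 0 1) := (isCompact_closedBall _ _).diff isOpen_ball
    have hcont : ContinuousOn (fun y => levelFun k (f₁ y)) (closedBall (0 : EuclideanSpace ℝ (Fin 2)) (1 + δ'') \ ball 0 1) := fun x hx =>
      (hlevc x (by
        have h1 : 1 ≤ ‖x‖ := by simpa using hx.2
        have h2 : ‖x‖ ≤ 1 + δ'' := mem_closedBall_zero_iff.1 hx.1
        rw [abs_lt]; constructor <;> linarith)).continuousWithinAt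
    obtain ⟨θ, hθ, hθc⟩ := Metric.uniformContinuousOn_iff.1 (hK0.uniformContinuousOn_of_continuous hcont) κ hκpos
    set δ' : ℝ := min (δ'' / 2) (θ / 2) with hδ'def
    have hδ'pos : 0 < δ' := lt_min (by linarith) (by linarith)
    have hδ'lt : δ' < δ'' := lt_of_le_of_lt (min_le_left _ _) (by linarith)
    have hδ'θ : δ' < θ := lt_of_le_of_lt (min_le_right _ _) (by linarith)
    refine ⟨δ', hδ'pos, hδ'lt, fun x hx hD => ?_⟩
    have hxn : ‖x‖ ≤ 1 + δ' := mem_closedBall_zero_iff.1 hx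
    rcases lt_or_ge ‖x‖ 1 with h1 | h1
    · exact hf.2.2.2.1 x h1 ⟨hD.1, by have := hD.2; linarith⟩
    · -- compare with the point of the unit circle on the same ray, where the level is `1`
      have hx0 : x ≠ 0 := by rintro rfl; simp at h1; linarith
      set u : EuclideanSpace ℝ (Fin 2) := ‖x‖⁻¹ • x with hu
      have hun : ‖u‖ = 1 := by rw [hu, norm_smul, norm_inv, norm_norm, inv_mul_cancel₀ (norm_ne_zero_iff.2 hx0)]
      have huK : levelFun k (f₁ u) = 1 := by
        let u' : (sphere (0 : EuclideanSpace ℝ (Fin 2)) 1) := ⟨u, by simpa using hun⟩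
        have : f₁ u = K₁ u' := hf.2.2.2.2 u'
        rw [this]; exact (hK.2.2.2 u').2
      have hxmem : x ∈ closedBall (0 : EuclideanSpace ℝ (Fin 2)) (1 + δ'') \ ball 0 1 :=
        ⟨mem_closedBall_zero_iff.2 (by linarith), by simpa using h1⟩
      have humem : u ∈ closedBall (0 : EuclideanSpace ℝ (Fin 2)) (1 + δ'') \ ball 0 1 :=
        ⟨mem_closedBall_zero_iff.2 (by linarith), by simp [hun]⟩
      have hdist : dist x u < θ := by
        have : x - u = (‖x‖ - 1) • u := by
          rw [sub_smul, one_smul, hu, smul_smul, mul_inv_cancel₀ (norm_ne_zero_iff.2 hx0), one_smul]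
        rw [dist_eq_norm, this, norm_smul, hun, mul_one, Real.norm_of_nonneg (by linarith)]; linarith
      have h := hθc x hxmem u humem hdist
      rw [Real.dist_eq, huK] at h
      have := hD.2
      rw [abs_lt] at h
      linarith [h.1]
  obtain ⟨ε, hε, hthick⟩ := ((isCompact_closedBall (0 : EuclideanSpace ℝ (Fin 2)) (1 + δ')).image hfs.continuous).exists_thickening_subset_open
    hDc.isOpen_compl (by rintro _ ⟨x, hx, rfl⟩; exact hdisc x hx)
  have hm₀c : Continuous m₀ := by
    have : m₀ = fun x => F (x, EuclideanSpace.single 0 1) - f₁ x := by funext x; simp [hF]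
    rw [this]; exact (hFc.comp (continuous_id.prodMk continuous_const)).sub hfs.continuous
  have hm₁c : Continuous m₁ := by
    have : m₁ = fun x => F (x, EuclideanSpace.single 1 1) - f₁ x := by funext x; simp [hF]
    rw [this]; exact (hFc.comp (continuous_id.prodMk continuous_const)).sub hfs.continuous
  obtain ⟨B, hB⟩ := (isCompact_closedBall (0 : EuclideanSpace ℝ (Fin 2)) (1 + δ')).exists_bound_of_continuousOn
    ((hm₀c.norm.add hm₁c.norm).continuousOn)
  have hBnn : ∀ x ∈ closedBall (0 : EuclideanSpace ℝ (Fin 2)) (1 + δ'), ‖m₀ x‖ + ‖m₁ x‖ ≤ |B| := fun x hx => by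
    have h := hB x hx
    simp only [Pi.add_apply, Real.norm_eq_abs, abs_of_nonneg (add_nonneg (norm_nonneg _) (norm_nonneg _))] at h
    exact h.trans (le_abs_self B)
  set η' : ℝ := min η (ε / (|B| + 1)) with hη'def
  have hη'pos : 0 < η' := lt_min hη (div_pos hε (by positivity))
  have hη'η : η' ≤ η := min_le_left _ _
  have hη'ε : η' * (|B| + 1) ≤ ε := by
    have := min_le_right η (ε / (|B| + 1)); rw [← hη'def] at this
    rwa [le_div_iff₀ (by positivity)] at this
  -- the punctured thin tube lies in `Z`
  set pdom' : Set (EuclideanSpace ℝ (Fin 2) × EuclideanSpace ℝ (Fin 2)) :=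
    ball (0 : EuclideanSpace ℝ (Fin 2)) (1 + δ') ×ˢ (ball (0 : EuclideanSpace ℝ (Fin 2)) η' ∩ {w | w ≠ 0}) with hpdom'
  have hFZ : ∀ q ∈ pdom', F q ∈ Z := by
    rintro ⟨x, w⟩ ⟨hx, hw, hw0⟩
    have hxn := mem_ball_zero_iff.1 hx
    have hwn := mem_ball_zero_iff.1 hw
    refine ⟨?_, fun hD => ?_⟩
    · rintro ⟨x', hx', he⟩
      rw [← hF0] at he
      have := hinjF (mk_mem_prod (mem_closedBall_zero_iff.2 (by linarith [mem_closedBall_zero_iff.1 hx'])) (by simpa using hη.le))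
        (mk_mem_prod (mem_closedBall_zero_iff.2 (by linarith)) (mem_closedBall_zero_iff.2 (by linarith))) he
      exact hw0 (congrArg Prod.snd this).symm
    · -- `F(x, w)` is `ε`-close to `f₁ x`, which is off `Dshr`
      have hclose : F (x, w) ∈ thickening ε (f₁ '' closedBall (0 : EuclideanSpace ℝ (Fin 2)) (1 + δ')) := by
        refine Metric.mem_thickening_iff.2 ⟨f₁ x, ⟨x, mem_closedBall_zero_iff.2 hxn.le, rfl⟩, ?_⟩
        rw [dist_eq_norm, hF]
        simp only
        rw [show f₁ x + w 0 • m₀ x + w 1 • m₁ x - f₁ x = w 0 • m₀ x + w 1 • m₁ x by abel]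
        have h0 : |w 0| ≤ ‖w‖ := by simpa [Real.norm_eq_abs] using PiLp.norm_apply_le w 0
        have h1 : |w 1| ≤ ‖w‖ := by simpa [Real.norm_eq_abs] using PiLp.norm_apply_le w 1
        calc ‖w 0 • m₀ x + w 1 • m₁ x‖ ≤ ‖w 0 • m₀ x‖ + ‖w 1 • m₁ x‖ := norm_add_le _ _
          _ = |w 0| * ‖m₀ x‖ + |w 1| * ‖m₁ x‖ := by rw [norm_smul, norm_smul, Real.norm_eq_abs, Real.norm_eq_abs]
          _ ≤ ‖w‖ * ‖m₀ x‖ + ‖w‖ * ‖m₁ x‖ := by gcongr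
          _ = ‖w‖ * (‖m₀ x‖ + ‖m₁ x‖) := by ring
          _ ≤ ‖w‖ * (|B| + 1) := mul_le_mul_of_nonneg_left (by linarith [hBnn x (mem_closedBall_zero_iff.2 hxn.le)]) (norm_nonneg w)
          _ < η' * (|B| + 1) := mul_lt_mul_of_pos_right hwn (by positivity)
          _ ≤ ε := hη'ε
      exact hthick hclose hD
  -- Step C: a push-off inside the thin tube
  set dom' : Set (EuclideanSpace ℝ (Fin 2) × EuclideanSpace ℝ (Fin 2)) :=
    ball (0 : EuclideanSpace ℝ (Fin 2)) (1 + δ') ×ˢ ball (0 : EuclideanSpace ℝ (Fin 2)) η' with hdom'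
  have hdom'sub : dom' ⊆ dom := prod_mono (ball_subset_ball (by linarith)) (ball_subset_ball hη'η)
  have himage : F '' dom' = F '' dom ∩ Finv ⁻¹' dom' := by
    ext y; constructor
    · rintro ⟨q, hq, rfl⟩
      exact ⟨⟨q, hdom'sub hq, rfl⟩, by show Finv (F q) ∈ dom'; rw [hleft q (hdom'sub hq)]; exact hq⟩
    · rintro ⟨⟨q, hq, rfl⟩, hq'⟩
      have : Finv (F q) = q := hleft q hq
      rw [mem_preimage, this] at hq'
      exact ⟨q, hq', rfl⟩
  have hopen' : IsOpen (F '' dom') := by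
    rw [himage]; exact hFinvc.isOpen_inter_preimage hopen (isOpen_ball.prod isOpen_ball)
  have hKT : ∀ u : (sphere (0 : EuclideanSpace ℝ (Fin 2)) 1), K₁ u ∈ F '' dom' := fun u =>
    ⟨((u : EuclideanSpace ℝ (Fin 2)), 0), ⟨mem_ball_zero_iff.2 (by rw [norm_eq_of_mem_sphere u]; linarith), by simpa using hη'pos⟩,
      by rw [hF0, hf.2.2.2.2 u]⟩
  obtain ⟨s₀, hs₀, hs₀T⟩ := exists_pushOff_mem hν.continuous hν0 hopen' hKT
  set s' : ℝ := min s s₀ with hs'def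
  have hs'pos : 0 < s' := lt_min hs hs₀
  have hs's : s' ≤ s := min_le_left _ _
  have hs's₀ : s' ≤ s₀ := min_le_right _ _
  set ℓ : (sphere (0 : EuclideanSpace ℝ (Fin 2)) 1) → EuclideanSpace ℝ (Fin 4) := fun u => νK (u, s' • EuclideanSpace.single 0 1) with hℓ
  have hℓc : Continuous ℓ := hν.continuous.comp (continuous_id.prodMk continuous_const)
  have hℓT : ∀ u, ℓ u ∈ F '' dom' := fun u => hs₀T u _ (by
    rw [norm_smul, PiLp.norm_single, norm_one, mul_one, Real.norm_eq_abs, abs_of_pos hs'pos]; exact hs's₀)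
  have hℓp : ∀ u, ℓ u ∈ F '' pdom' := fun u => by
    obtain ⟨q, hq, hqe⟩ := hℓT u
    refine ⟨q, ⟨hq.1, hq.2, fun hq0 => ?_⟩, hqe⟩
    have h := hne u s' hs'pos hs's
    change (Finv (ℓ u)).2 ≠ 0 at h
    rw [← hqe, hleft q (hdom'sub hq)] at h
    exact h hq0
  -- Step D: the glue, fed by the two local facts
  have hZsub : F '' pdom' ⊆ Z := by rintro _ ⟨q, hq, rfl⟩; exact hFZ q hq
  obtain ⟨G₁, hG₁c, hG₁0, hG₁s, e₁, hG₁e⟩ := exists_nullhomotopy_of_classes F Finv (1 + δ') η' hη'pos hFc.continuousOn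
    (hFinvc.mono (image_mono hdom'sub)) (fun q hq => hleft q (hdom'sub hq)) Z hZsub ℓ hℓc hℓp
    (fun p γ hγ => by
      -- fact (I): the push-off is null-homologous in `M_k ∖ K₁ ⊆ Z`
      have hmem : ∀ t : unitInterval, νK (circlePoint (2 * Real.pi * t), s' • EuclideanSpace.single 0 1) ∈
          {y : EuclideanSpace ℝ (Fin 4) | y ∈ modelBoundary k ∧ y ∉ range K₁} := fun t => by
        refine ⟨hνM _, ?_⟩
        rintro ⟨u', hu'⟩
        rw [← hν0] at hu'
        have := congrArg Prod.snd (hνinj hu')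
        have h1 := congrArg (fun z : EuclideanSpace ℝ (Fin 2) => z 0) this
        simp at h1
        exact hs'pos.ne' h1.symm
      let a : ↥{y : EuclideanSpace ℝ (Fin 4) | y ∈ modelBoundary k ∧ y ∉ range K₁} := ⟨_, hmem 0⟩
      have hends : νK (circlePoint (2 * Real.pi * (1 : ℝ)), s' • EuclideanSpace.single 0 1) = νK (circlePoint (2 * Real.pi * (0 : ℝ)), s' • EuclideanSpace.single 0 1) := by
        rw [mul_one, mul_zero, ← zero_add (2 * Real.pi), circlePoint_add_two_pi]
      let γA : Path a a :=
        { toFun := fun t => ⟨_, hmem t⟩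
          continuous_toFun := (hν.continuous.comp ((continuous_circlePoint.comp (continuous_const.mul continuous_subtype_val)).prodMk
            continuous_const)).subtype_mk _
          source' := by apply Subtype.ext; simp [a]
          target' := by apply Subtype.ext; change νK (circlePoint (2 * Real.pi * (1 : ℝ)), _) = νK (circlePoint (2 * Real.pi * (0 : ℝ)), _); exact hends }
      exact loopClass_eq_zero_of_subset hMZ γA γ (fun t => by rw [hγ t]; rfl) (hI s' hs'pos a γA fun t => rfl))
    (fun p μ hp hμ n hn => by
      -- fact (III): the meridian through `p` bounds a flat punctured disc in the thin tube
      set x₀ := (Finv (p : EuclideanSpace ℝ (Fin 4))).1 with hx₀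
      set w₀ := (Finv (p : EuclideanSpace ℝ (Fin 4))).2 with hw₀
      obtain ⟨q₀, hq₀, hq₀e⟩ : (p : EuclideanSpace ℝ (Fin 4)) ∈ F '' pdom' := by rw [hp]; exact hℓp _
      have hFq₀ : Finv (p : EuclideanSpace ℝ (Fin 4)) = q₀ := by rw [← hq₀e]; exact hleft q₀ (hdom'sub ⟨hq₀.1, hq₀.2.1⟩)
      have hx₀b : ‖x₀‖ < 1 + δ' := by rw [hx₀, hFq₀]; exact mem_ball_zero_iff.1 hq₀.1
      have hw₀b : ‖w₀‖ < η' := by rw [hw₀, hFq₀]; exact mem_ball_zero_iff.1 hq₀.2.1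
      have hw₀0 : w₀ ≠ 0 := by rw [hw₀, hFq₀]; exact hq₀.2.2
      refine hIII δ'' κ Z rfl hδ''pos hκpos hκ20 (hinjf.mono (closedBall_subset_closedBall (by linarith))) hcollar hrim
        x₀ (m₀ x₀) (m₁ x₀) (toC w₀) (by linarith) (hdisc x₀ (mem_closedBall_zero_iff.2 hx₀b.le))
        (htr x₀ (mem_ball_zero_iff.2 (by linarith))) (toC_ne_zero hw₀0) (fun z hz0 hzn => ?_) p μ (fun t => ?_) n hn
      · have : f₁ x₀ + (ofC z) 0 • m₀ x₀ + (ofC z) 1 • m₁ x₀ = F (x₀, ofC z) := by rw [hF]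
        rw [this]
        refine hFZ _ ⟨mem_ball_zero_iff.2 hx₀b, mem_ball_zero_iff.2 ?_, ofC_ne_zero hz0⟩
        rw [Knot.TubularNbhd.norm_ofC]; rw [norm_toC] at hzn; linarith
      · rw [hμ t, hF])
  -- Step E: from the push-off at `s'` to the push-off at `s`
  let Y := {v : EuclideanSpace ℝ (Fin 2) // v ≠ 0}
  have hΨc : ContinuousOn (fun q : (sphere (0 : EuclideanSpace ℝ (Fin 2)) 1) × ℝ => (Finv (νK (q.1, q.2 • EuclideanSpace.single 0 1))).2)
      (univ ×ˢ Icc s' s) := by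
    refine (continuous_snd.comp_continuousOn (hFinvc.comp (hν.continuous.comp (continuous_fst.prodMk
      ((continuous_snd.smul continuous_const)))).continuousOn fun q hq => ?_))
    exact hpush q.1 q.2 (lt_of_lt_of_le hs'pos hq.2.1) hq.2.2
  let g₀ : C((sphere (0 : EuclideanSpace ℝ (Fin 2)) 1), Y) :=
    ⟨fun u => ⟨(Finv (νK (u, s • EuclideanSpace.single 0 1))).2, hne u s hs le_rfl⟩,
      (hΨc.comp_continuous (continuous_id.prodMk continuous_const) fun u => ⟨mem_univ _, hs's, le_rfl⟩).subtype_mk _⟩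
  let g₁ : C((sphere (0 : EuclideanSpace ℝ (Fin 2)) 1), Y) :=
    ⟨fun u => ⟨(Finv (νK (u, s' • EuclideanSpace.single 0 1))).2, hne u s' hs'pos hs's⟩,
      (hΨc.comp_continuous (continuous_id.prodMk continuous_const) fun u => ⟨mem_univ _, le_rfl, hs's⟩).subtype_mk _⟩
  let g₂ : C((sphere (0 : EuclideanSpace ℝ (Fin 2)) 1), Y) :=
    ⟨fun _ => ⟨e₁, by rw [← hG₁e (⟨EuclideanSpace.single 0 1, by simp⟩ : (sphere (0 : EuclideanSpace ℝ (Fin 2)) 1))]; exact hG₁0 _⟩,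
      continuous_const⟩
  have H₁ : ContinuousMap.Homotopy g₀ g₁ :=
    { toFun := fun q => ⟨(Finv (νK (q.2, (s + (q.1 : ℝ) * (s' - s)) • EuclideanSpace.single 0 1))).2,
        hne q.2 _ (by nlinarith [mul_nonneg (sub_nonneg.2 q.1.2.2) (sub_nonneg.2 hs's), hs'pos]) (by nlinarith [mul_nonneg q.1.2.1 (sub_nonneg.2 hs's)])⟩
      continuous_toFun := by
        refine Continuous.subtype_mk ?_ _
        have hc2 : Continuous fun q : unitInterval × (sphere (0 : EuclideanSpace ℝ (Fin 2)) 1) => ((q.2, s + (q.1 : ℝ) * (s' - s)) :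
            (sphere (0 : EuclideanSpace ℝ (Fin 2)) 1) × ℝ) := by fun_prop
        refine hΨc.comp_continuous hc2 fun q => ⟨mem_univ _, ?_, ?_⟩
        · change s' ≤ s + (q.1 : ℝ) * (s' - s)
          nlinarith [mul_nonneg (sub_nonneg.2 q.1.2.2) (sub_nonneg.2 hs's)]
        · change s + (q.1 : ℝ) * (s' - s) ≤ s
          nlinarith [mul_nonneg q.1.2.1 (sub_nonneg.2 hs's)]
      map_zero_left := fun u => by apply Subtype.ext; simp [g₀]
      map_one_left := fun u => by apply Subtype.ext; simp [g₁] }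
  have H₂ : ContinuousMap.Homotopy g₁ g₂ :=
    { toFun := fun q => ⟨G₁ q, hG₁0 q⟩
      continuous_toFun := hG₁c.subtype_mk _
      map_zero_left := fun u => Subtype.ext (hG₁s u)
      map_one_left := fun u => Subtype.ext (hG₁e u) }
  let H := H₁.trans H₂
  refine ⟨fun q => ((H q : Y) : EuclideanSpace ℝ (Fin 2)), continuous_subtype_val.comp H.continuous, fun q => (H q).2,
    fun u => ?_, e₁, fun u => ?_⟩
  · show ((H (0, u) : Y) : EuclideanSpace ℝ (Fin 2)) = _
    rw [H.apply_zero]; rfl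
  · show ((H (1, u) : Y) : EuclideanSpace ℝ (Fin 2)) = _
    rw [H.apply_one]; rfl

end FriendsCarrierVk

open FriendsCarrierVk in
/-- **Helper `helper_friendsCarrier_Vk_partA_pushLocal`** (piece of `helper_friendsCarrier_Vk_partA`: the push-off
input from the two local homological facts — (I) the push-offs of `νK` are null-homologous in `M_k ∖ K₁`,
(III) in `ℝ⁴ ∖ (f₁(B̄(0,1+δ)) ∪ D_k^{≤1-κ})` (neat-zone `δ`, small `κ`) the boundaries of small flat discs
transverse to the enlarged disc have infinite order in `H₁` — for the given knot, tube and disc; see the module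
docstring). [cite: Kirby1989, Ch. I §2] -/
theorem helper_friendsCarrier_Vk_partA_pushLocal : ∀ (k : ℕ) (K₁ : (sphere (0 : EuclideanSpace ℝ (Fin 2)) 1) → EuclideanSpace ℝ (Fin 4)) (f₁ : EuclideanSpace ℝ (Fin 2) → EuclideanSpace ℝ (Fin 4)) (νK : (sphere (0 : EuclideanSpace ℝ (Fin 2)) 1) × EuclideanSpace ℝ (Fin 2) → EuclideanSpace ℝ (Fin 4)), IsModelKnot k K₁ → IsModelSliceDisc k K₁ f₁ → (∀ t : (sphere (0 : EuclideanSpace ℝ (Fin 2)) 1), deriv (fun ρ : ℝ => levelFun k (f₁ (ρ • (t : EuclideanSpace ℝ (Fin 2))))) 1 < 0) → ContMDiff ((𝓡 1).prod 𝓘(ℝ, EuclideanSpace ℝ (Fin 2))) 𝓘(ℝ, EuclideanSpace ℝ (Fin 4)) ∞ νK → Injective νK → (∀ p, νK p ∈ modelBoundary k) → (∀ u : (sphere (0 : EuclideanSpace ℝ (Fin 2)) 1), νK (u, 0) = K₁ u) → (∀ (s : ℝ), 0 < s → ∀ (p : ↥{y : EuclideanSpace ℝ (Fin 4) | y ∈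 modelBoundary k ∧ y ∉ range K₁}) (γ : Path p p), (∀ t, ((γ t : ↥{y : EuclideanSpace ℝ (Fin 4) | y ∈ modelBoundary k ∧ y ∉ range K₁}) : EuclideanSpace ℝ (Fin 4)) = νK (circlePoint (2 * Real.pi * t), s • EuclideanSpace.single 0 1)) → loopClass ℤ ℤ (1 : ℤ) γ = 0) → (∀ (δ κ : ℝ) (Zs : Set (EuclideanSpace ℝ (Fin 4))), Zs = {y | y ∉ f₁ '' closedBall 0 (1 + δ) ∧ ¬ ((∀ j, (1 : ℝ) ≤ holeTerm k j y) ∧ levelFun k y ≤ 1 - κ)} → 0 < δ → 0 < κ → κ ≤ 1 / 20 → InjOn f₁ (closedBall 0 (1 + δ)) → (∀ x : EuclideanSpace ℝ (Fin 2), 1 ≤ ‖x‖ → ‖x‖ ≤ 1 + δ → Injective (fderiv ℝ f₁ x) ∧ (∀ j, (1 : ℝ) / 2 < holeTerm k j (f₁ x)) ∧ fderiv ℝ (fun y => levelFun k (f₁ y)) x (‖x‖⁻¹ • x) < 0) → (∀ u : (sphere (0 : EuclideanSpace ℝ (Fin 2)) 1), levelFun k (f₁ ((1 + δ) • (u : EuclideanSpace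 ℝ (Fin 2)))) < 1 - κ) → ∀ (x₀ : EuclideanSpace ℝ (Fin 2)) (n₀ n₁ : EuclideanSpace ℝ (Fin 4)) (c : ℂ), ‖x₀‖ < 1 + δ → ¬ ((∀ j, (1 : ℝ) ≤ holeTerm k j (f₁ x₀)) ∧ levelFun k (f₁ x₀) ≤ 1 - κ) → (∀ (e : EuclideanSpace ℝ (Fin 2)) (α β : ℝ), fderiv ℝ f₁ x₀ e + α • n₀ + β • n₁ = 0 → e = 0 ∧ α = 0 ∧ β = 0) → c ≠ 0 → (∀ z : ℂ, z ≠ 0 → ‖z‖ ≤ ‖c‖ → f₁ x₀ + (PlaneComplex.ofC z) 0 • n₀ + (PlaneComplex.ofC z) 1 • n₁ ∈ Zs) → ∀ (p : ↥Zs) (μ : Path p p), (∀ t, ((μ t : ↥Zs) : EuclideanSpace ℝ (Fin 4)) = f₁ x₀ + (PlaneComplex.ofC (Complex.exp (((2 * Real.pi * t : ℝ) : ℂ) * Complex.I) * c)) 0 • n₀ + (PlaneComplex.ofC (Complex.exp (((2 * Real.pi * t : ℝ) : ℂ) * Complex.I) * c)) 1 • n₁) → ∀ n : ℤ, n • loopClass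 ℤ ℤ (1 : ℤ) μ = 0 → n = 0) → ∀ (m₀ m₁ : EuclideanSpace ℝ (Fin 2) → EuclideanSpace ℝ (Fin 4)) (F : EuclideanSpace ℝ (Fin 2) × EuclideanSpace ℝ (Fin 2) → EuclideanSpace ℝ (Fin 4)) (Finv : EuclideanSpace ℝ (Fin 4) → EuclideanSpace ℝ (Fin 2) × EuclideanSpace ℝ (Fin 2)) (δ η s : ℝ), (∀ q, F q = f₁ q.1 + q.2 0 • m₀ q.1 + q.2 1 • m₁ q.1) → Continuous F → 0 < δ → 0 < η → 0 < s → InjOn f₁ (closedBall 0 (1 + δ)) → (∀ x ∈ ball (0 : EuclideanSpace ℝ (Fin 2)) (1 + 2 * δ), ∀ (e : EuclideanSpace ℝ (Fin 2)) (α β : ℝ), fderiv ℝ f₁ x e + α • m₀ x + β • m₁ x = 0 → e = 0 ∧ α = 0 ∧ β = 0) → InjOn F (closedBall (0 : EuclideanSpace ℝ (Fin 2)) (1 + δ) ×ˢ closedBall (0 : EuclideanSpace ℝ (Fin 2)) η) → IsOpen (F '' (ball (0 : EuclideanSpace ℝ (Fin 2)) (1 + δ) ×ˢ ball (0 : EuclideanSpace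 ℝ (Fin 2)) η)) → ContinuousOn Finv (F '' (ball (0 : EuclideanSpace ℝ (Fin 2)) (1 + δ) ×ˢ ball (0 : EuclideanSpace ℝ (Fin 2)) η)) → (∀ q ∈ ball (0 : EuclideanSpace ℝ (Fin 2)) (1 + δ) ×ˢ ball (0 : EuclideanSpace ℝ (Fin 2)) η, Finv (F q) = q) → (∀ (u : (sphere (0 : EuclideanSpace ℝ (Fin 2)) 1)) (ρ : ℝ), 1 < ρ → ρ ≤ 1 + δ → levelFun k (f₁ (ρ • (u : EuclideanSpace ℝ (Fin 2)))) < 1) → (∀ (u : (sphere (0 : EuclideanSpace ℝ (Fin 2)) 1)) (t : ℝ), 0 < t → t ≤ s → νK (u, t • EuclideanSpace.single 0 1) ∈ F '' (ball (0 : EuclideanSpace ℝ (Fin 2)) (1 + δ) ×ˢ ball (0 : EuclideanSpace ℝ (Fin 2)) η)) → ∃ G : unitInterval × (sphere (0 : EuclideanSpace ℝ (Fin 2)) 1) → EuclideanSpace ℝ (Fin 2), Continuous G ∧ (∀ p, G p ≠ 0) ∧ (∀ u, G (0, u) = (Finv (νK (u, s • EuclideanSpace.single 0 1))).2) ∧ ∃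 e : EuclideanSpace ℝ (Fin 2), ∀ u, G (1, u) = e := by
  intro k K₁ f₁ νK hK hf hneat hν hνinj hνM hν0 hI hIII m₀ m₁ F Finv δ η s hF hFc hδ hη hs hinjf htr hinjF hopen hFinvc hleft hcol hpush
  exact pushOff_of_localFacts hK hf hneat hν hνinj hνM hν0 hI hIII m₀ m₁ F Finv δ η s hF hFc hδ hη hs hinjf htr hinjF hopen hFinvc hleft hcol hpush

end Summit.SmoothPoincare4.SmoothPoincare4.Theorems.DcrGap.MkFriends

end
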